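import Mathlib
import Literature.NumberTheory.LFunctions.Zhang2022.TypedAppendixA2
import Literature.NumberTheory.LFunctions.Zhang2022.AppendixAEulerFactorM2
import Literature.NumberTheory.LFunctions.Zhang2022.AppendixALemma161
import Literature.NumberTheory.LFunctions.Zhang2022.AppendixALemma161Bridge
import Literature.NumberTheory.LFunctions.Zhang2022.AppendixALemma161Typed
import Literature.NumberTheory.LFunctions.Zhang2022.AppendixALemma161Steps
import Literature.NumberTheory.LFunctions.Zhang2022.AppendixALemma161Estimates

/-!
# Zhang (2022) Appendix A, proof of Lemma 16.1 (viii): the typed displays u033–u037 hold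

Topic `Literature/NumberTheory/LFunctions/Zhang2022` (Landau–Siegel audit tree; verdict-neutral).
Y. Zhang, *Discrete mean estimates and the Landau–Siegel zero*, arXiv:2211.02515v1 (2022)
[Zhang2022LandauSiegel] — **an unrefereed manuscript under adjudication**; this file PROVES L4-t9's
typed nodes of the Appendix-A proof of Lemma 16.1 — `Typed.AppendixA2.StepA_u033`, `StepA_u034a/b/c`,
`StepA_u034`, `StepA_u035`, `StepA_u036`, `StepA_u037` (DAG `Z22:§A.u033`–`Z22:§A.u037`, [Z22 p. 105,
tex L5195–L5216]) — and asserts nothing else about the manuscript's theorems. (`StepA_u038` is not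
treated; Lemma 16.1 itself is `AppendixALemma161Typed.lemma161_holds`, and the deduction node
`Typed.AppendixA2.Lem161_pf` (`Z22:Lem16.1.pf`) is the tree theorem `Typed.AppendixA2.lem161_pf_holds`.)
The `ForAllLarge` threshold is `D₀(c′) = ⌈e^{3+|c′|}⌉`, beyond which `(1 + |c′|/2)·α𝓛 ≤ 1/5`; the
`O`-constants are explicit affine functions of `|c′|` (crude).

## References
* Y. Zhang, arXiv:2211.02515v1 (2022), Appendix A p. 105. [cite: Zhang2022LandauSiegel, App. A p. 105]
-/

noncomputable section

open Complex Real Finset Filter Topology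
open ArithmeticFunction hiding log

namespace Literature.NumberTheory.LFunctions.Zhang2022.AppendixA

open MeanSquareMajorant
open Literature.NumberTheory.LFunctions.Zhang2022.Typed

/-! ## §4. The typed displays u033, u034a–c, u035, u036, u037 -/

section TypedSteps

open Literature.NumberTheory.LFunctions.Zhang2022.Typed

/-- The threshold `D₀(c′) = ⌈e^{3+|c′|}⌉`: beyond it `𝓛 ≥ 3 + |c′|`. [cite: Zhang2022LandauSiegel, §2 (2.1)] -/
private theorem ell_ge {c' : ℝ} {D : ℕ} (hD : ⌈Real.exp (3 + |c'|)⌉₊ ≤ D) : 3 + |c'| ≤ Skeleton.ell D := by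
  have h : Real.exp (3 + |c'|) ≤ D := le_trans (Nat.le_ceil _) (by exact_mod_cast hD)
  exact (Real.le_log_iff_exp_le (lt_of_lt_of_le (Real.exp_pos _) h)).mpr h

/-- The parameters beyond `D₀(c′)`: `α = π𝓛⁻⁹ ≥ 0`, `α ≤ 1/50`, `α𝓛 ≤ 1/10`, `|b₁| ≤ (1 + |c′|/2)α`,
`(1 + |c′|/2)α𝓛 ≤ 1/5`, `𝓛 > 0`. [cite: Zhang2022LandauSiegel, §2 (2.10), (2.13)] -/
private theorem params {c' : ℝ} {D : ℕ} (hD : ⌈Real.exp (3 + |c'|)⌉₊ ≤ D) :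
    0 ≤ Skeleton.alpha D ∧ Skeleton.alpha D ≤ 1 / 50 ∧ Skeleton.alpha D * Skeleton.ell D ≤ 1 / 10 ∧
      |Skeleton.b1 c' D| ≤ (1 + |c'| / 2) * Skeleton.alpha D ∧
      (1 + |c'| / 2) * Skeleton.alpha D * Skeleton.ell D ≤ 1 / 5 ∧ 0 < Skeleton.ell D := by
  have hℓc := ell_ge hD
  have hc0 : 0 ≤ |c'| := abs_nonneg _
  have hℓ3 : 3 ≤ Skeleton.ell D := by linarith
  have hℓ0 : 0 < Skeleton.ell D := by linarith
  have hα : Skeleton.alpha D = π / Skeleton.ell D ^ 9 := by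
    unfold Skeleton.alpha Skeleton.bigP; rw [Real.log_exp]
  have hα0 : 0 ≤ Skeleton.alpha D := by rw [hα]; positivity
  have hℓ9 : (3 : ℝ) ^ 9 ≤ Skeleton.ell D ^ 9 := by gcongr
  have hℓ8 : (3 : ℝ) ^ 8 ≤ Skeleton.ell D ^ 8 := by gcongr
  have hℓ7 : (3 : ℝ) ^ 7 ≤ Skeleton.ell D ^ 7 := by gcongr
  have hπ4 : π ≤ 4 := Real.pi_le_four
  have hα50 : Skeleton.alpha D ≤ 1 / 50 := by
    rw [hα, div_le_iff₀ (by positivity)]; nlinarith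
  have hαℓ_eq : Skeleton.alpha D * Skeleton.ell D = π / Skeleton.ell D ^ 8 := by
    rw [hα]; field_simp
  have hαℓ : Skeleton.alpha D * Skeleton.ell D ≤ 1 / 10 := by
    rw [hαℓ_eq, div_le_iff₀ (by positivity)]; nlinarith
  have hcαℓ : (1 + |c'| / 2) * Skeleton.alpha D * Skeleton.ell D ≤ 1 / 5 := by
    rw [mul_assoc, hαℓ_eq, ← mul_div_assoc, div_le_iff₀ (by positivity)]
    -- `𝓛⁸ = 𝓛⁷·𝓛 ≥ 3⁷(3 + |c′|)` and `(1 + |c′|/2)π ≤ (1/5)·3⁷(3+|c′|)`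
    have h1 : (3 : ℝ) ^ 7 * (3 + |c'|) ≤ Skeleton.ell D ^ 8 := by
      calc (3 : ℝ) ^ 7 * (3 + |c'|) ≤ Skeleton.ell D ^ 7 * Skeleton.ell D :=
            mul_le_mul hℓ7 hℓc (by linarith) (by positivity)
        _ = Skeleton.ell D ^ 8 := by ring
    nlinarith
  have hb1 : |Skeleton.b1 c' D| ≤ (1 + |c'| / 2) * Skeleton.alpha D := by
    unfold Skeleton.b1
    rw [abs_mul, abs_of_nonneg hα0, mul_comm]
    gcongr
    calc |1 - 5 * c' * Skeleton.alpha D * Skeleton.ell D|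
        ≤ |(1 : ℝ)| + |5 * c' * Skeleton.alpha D * Skeleton.ell D| := abs_sub _ _
      _ = 1 + 5 * |c'| * (Skeleton.alpha D * Skeleton.ell D) := by
          rw [abs_one, abs_mul, abs_mul, abs_mul, abs_of_nonneg hα0, abs_of_nonneg hℓ0.le,
            abs_of_nonneg (by norm_num : (0:ℝ) ≤ 5)]; ring
      _ ≤ 1 + 5 * |c'| * (1 / 10) := by gcongr
      _ = 1 + |c'| / 2 := by ring
  exact ⟨hα0, hα50, hαℓ, hb1, hcαℓ, hℓ0⟩

/-- The per-prime data in Lemma 16.1's range: beyond `D₀(c′)`, for a prime `q ≤ D` and `|s−1| < 5α`: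
`‖q^{−s}‖ ≤ 3/5`, `‖q^{−s}‖ ≤ 2/q`, `‖1 − q·q^{−s}‖ ≤ 2|s−1| log q`, `‖q·q^{−s}‖ ≤ 2`, and
`|b₁| log q ≤ 1/5`. [cite: Zhang2022LandauSiegel, App. A p. 105] -/
private theorem perPrime {c' : ℝ} {D : ℕ} (hD : ⌈Real.exp (3 + |c'|)⌉₊ ≤ D) {q : ℕ} (hq : q.Prime)
    (hqD : q ≤ D) {s : ℂ} (hs : ‖s - 1‖ < 5 * Skeleton.alpha D) :
    ‖(q : ℂ) ^ (-s)‖ ≤ 3 / 5 ∧ ‖(q : ℂ) ^ (-s)‖ ≤ 2 / q ∧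
      ‖1 - (q : ℂ) * (q : ℂ) ^ (-s)‖ ≤ 2 * ‖s - 1‖ * Real.log q ∧ ‖(q : ℂ) * (q : ℂ) ^ (-s)‖ ≤ 2 ∧
      |Skeleton.b1 c' D| * Real.log q ≤ 1 / 5 := by
  obtain ⟨hα0, hα50, hαℓ, hb1, hcαℓ, hℓ0⟩ := params hD
  have hσ : 9 / 10 ≤ s.re := by
    have h := Complex.abs_re_le_norm (s - 1)
    rw [Complex.sub_re, Complex.one_re] at h
    have := (abs_le.mp (h.trans (by linarith : ‖s - 1‖ ≤ 1 / 10))).1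
    linarith
  obtain ⟨-, hx⟩ := norm_cpow_neg_le_three_fifths hq.two_le hσ
  have hq0 : (0 : ℝ) < q := by exact_mod_cast hq.pos
  have hlogq : Real.log q ≤ Skeleton.ell D := Real.log_le_log hq0 (by exact_mod_cast hqD)
  have hlog0 : 0 ≤ Real.log q := Real.log_natCast_nonneg _
  have hsl : ‖s - 1‖ * Real.log q ≤ 1 / 2 := by
    calc ‖s - 1‖ * Real.log q ≤ (5 * Skeleton.alpha D) * Skeleton.ell D :=
          mul_le_mul hs.le hlogq hlog0 (by positivity)
      _ = 5 * (Skeleton.alpha D * Skeleton.ell D) := by ring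
      _ ≤ 1 / 2 := by linarith
  obtain ⟨h1x, hqx⟩ := norm_one_sub_mul_cpow_neg_le hq.pos hsl
  have hx2 : ‖(q : ℂ) ^ (-s)‖ ≤ 2 / q := by
    rw [norm_mul, Complex.norm_natCast] at hqx
    rw [le_div_iff₀ hq0]; linarith
  have hb : |Skeleton.b1 c' D| * Real.log q ≤ 1 / 5 :=
    calc |Skeleton.b1 c' D| * Real.log q ≤ (1 + |c'| / 2) * Skeleton.alpha D * Skeleton.ell D := by gcongr
      _ ≤ 1 / 5 := hcαℓ
  exact ⟨hx, hx2, h1x, hqx, hb⟩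

/-- **u033 holds** (`Typed.AppendixA2.StepA_u033 c′`). [cite: Zhang2022LandauSiegel, App. A p. 105] -/
theorem stepA_u033_holds (c' : ℝ) : AppendixA2.StepA_u033 c' :=
  fun _D _ χ _q _r d l hq hr _ _ => xi2_prime_pow c' χ d l hq hr

variable (c' : ℝ) in
/-- `StepA_u033` — `_holds` alias of `stepA_u033_holds` above under the fact's exact name, stated under the
prover's own binders as section variables (appended 2026-08-28, D-0026 bookkeeping: the proof term is the
existing theorem of this file; no statement, definition or attribute is edited; no new named fact; the
ledger's debt table listed the fact unproved). [cite: Zhang2022LandauSiegel, App. A p. 105] -/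
theorem _root_.Literature.NumberTheory.LFunctions.Zhang2022.Typed.AppendixA2.StepA_u033_holds :
    _root_.Literature.NumberTheory.LFunctions.Zhang2022.Typed.AppendixA2.StepA_u033 c' :=
  _root_.Literature.NumberTheory.LFunctions.Zhang2022.AppendixA.stepA_u033_holds (c' := c')

/-- **u034, identity part, holds** (`Typed.AppendixA2.StepA_u034a c′`).
[cite: Zhang2022LandauSiegel, App. A p. 105] -/
theorem stepA_u034a_holds (c' : ℝ) : AppendixA2.StepA_u034a c' :=
  fun _D _q _r hq hr => norm_kappa2_prime_pow c' hq hr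

variable (c' : ℝ) in
/-- `StepA_u034a` — `_holds` alias of `stepA_u034a_holds` above under the fact's exact name, stated under the
prover's own binders as section variables (appended 2026-08-28, D-0026 bookkeeping: the proof term is the
existing theorem of this file; no statement, definition or attribute is edited; no new named fact; the
ledger's debt table listed the fact unproved). [cite: Zhang2022LandauSiegel, App. A p. 105] -/
theorem _root_.Literature.NumberTheory.LFunctions.Zhang2022.Typed.AppendixA2.StepA_u034a_holds :
    _root_.Literature.NumberTheory.LFunctions.Zhang2022.Typed.AppendixA2.StepA_u034a c' :=
  _root_.Literature.NumberTheory.LFunctions.Zhang2022.AppendixA.stepA_u034a_holds (c' := c')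

/-- **u034, the bound `|q^{−β₁} − 1| ≪ α log q`, holds** (`Typed.AppendixA2.StepA_u034b c′`), with
`C = 1 + |c′|/2` beyond `D₀(c′)` (`|q^{−β₁} − 1| ≤ |b₁| log q`, `|b₁| ≤ (1+|c′|/2)α`).
[cite: Zhang2022LandauSiegel, App. A p. 105] -/
theorem stepA_u034b_holds (c' : ℝ) : AppendixA2.StepA_u034b c' := by
  refine ⟨1 + |c'| / 2, ⌈Real.exp (3 + |c'|)⌉₊, fun D _ χ hD _ _ _ q hq => ?_⟩
  obtain ⟨hα0, -, -, hb1, -⟩ := params hD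
  obtain ⟨-, hw1⟩ := norm_cpow_neg_beta1 c' (D := D) hq.pos
  calc _ ≤ |Skeleton.b1 c' D| * Real.log q := hw1
    _ ≤ (1 + |c'| / 2) * Skeleton.alpha D * Real.log q :=
        mul_le_mul_of_nonneg_right hb1 (Real.log_natCast_nonneg _)
    _ = (1 + |c'| / 2) * (Skeleton.alpha D * Real.log q) := by ring

variable (c' : ℝ) in
/-- `StepA_u034b` — `_holds` alias of `stepA_u034b_holds` above under the fact's exact name, stated under the
prover's own binders as section variables (appended 2026-08-28, D-0026 bookkeeping: the proof term is the
existing theorem of this file; no statement, definition or attribute is edited; no new named fact; the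
ledger's debt table listed the fact unproved). [cite: Zhang2022LandauSiegel, App. A p. 105] -/
theorem _root_.Literature.NumberTheory.LFunctions.Zhang2022.Typed.AppendixA2.StepA_u034b_holds :
    _root_.Literature.NumberTheory.LFunctions.Zhang2022.Typed.AppendixA2.StepA_u034b c' :=
  _root_.Literature.NumberTheory.LFunctions.Zhang2022.AppendixA.stepA_u034b_holds (c' := c')

/-- **u034, the relation `λ̃₂(q,d) = 1 + O(α log q/q)`, holds** (`Typed.AppendixA2.StepA_u034c c′`), with
`C = 2 + |c′|`. [cite: Zhang2022LandauSiegel, App. A p. 105] -/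
theorem stepA_u034c_holds (c' : ℝ) : AppendixA2.StepA_u034c c' := by
  refine ⟨2 + |c'|, ⌈Real.exp (3 + |c'|)⌉₊, fun D _ χ hD _ _ _ q d hq _ => ?_⟩
  obtain ⟨hα0, -, -, hb1, -⟩ := params hD
  have hlog0 : 0 ≤ Real.log q := Real.log_natCast_nonneg _
  have hq0 : (0 : ℝ) < q := by exact_mod_cast hq.pos
  rw [lamTilde2_prime c' χ hq d]
  split_ifs with h
  · obtain ⟨-, hw1⟩ := norm_cpow_neg_beta1 c' (D := D) hq.pos
    calc _ ≤ 2 * (|Skeleton.b1 c' D| * Real.log q) / q :=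
          norm_locLam_sub_one_le (DirichletCharacter.norm_le_one χ _) hq.two_le hw1
      _ ≤ 2 * ((1 + |c'| / 2) * Skeleton.alpha D * Real.log q) / q := by gcongr
      _ = (2 + |c'|) * (Skeleton.alpha D * Real.log q / q) := by ring
  · rw [sub_self, norm_zero]; positivity

variable (c' : ℝ) in
/-- `StepA_u034c` — `_holds` alias of `stepA_u034c_holds` above under the fact's exact name, stated under the
prover's own binders as section variables (appended 2026-08-28, D-0026 bookkeeping: the proof term is the
existing theorem of this file; no statement, definition or attribute is edited; no new named fact; the
ledger's debt table listed the fact unproved). [cite: Zhang2022LandauSiegel, App. A p. 105] -/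
theorem _root_.Literature.NumberTheory.LFunctions.Zhang2022.Typed.AppendixA2.StepA_u034c_holds :
    _root_.Literature.NumberTheory.LFunctions.Zhang2022.Typed.AppendixA2.StepA_u034c c' :=
  _root_.Literature.NumberTheory.LFunctions.Zhang2022.AppendixA.stepA_u034c_holds (c' := c')

/-- **u034 holds** (`Typed.AppendixA2.StepA_u034 c′` = the three parts). [cite: Zhang2022LandauSiegel, App. A p. 105] -/
theorem stepA_u034_holds (c' : ℝ) : AppendixA2.StepA_u034 c' :=
  ⟨stepA_u034a_holds c', stepA_u034b_holds c', stepA_u034c_holds c'⟩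

variable (c' : ℝ) in
/-- `StepA_u034` — `_holds` alias of `stepA_u034_holds` above under the fact's exact name, stated under the
prover's own binders as section variables (appended 2026-08-28, D-0026 bookkeeping: the proof term is the
existing theorem of this file; no statement, definition or attribute is edited; no new named fact; the
ledger's debt table listed the fact unproved). [cite: Zhang2022LandauSiegel, App. A p. 105] -/
theorem _root_.Literature.NumberTheory.LFunctions.Zhang2022.Typed.AppendixA2.StepA_u034_holds :
    _root_.Literature.NumberTheory.LFunctions.Zhang2022.Typed.AppendixA2.StepA_u034 c' :=
  _root_.Literature.NumberTheory.LFunctions.Zhang2022.AppendixA.stepA_u034_holds (c' := c')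

/-- **u037 holds** (`Typed.AppendixA2.StepA_u037 c′`): `(1−q^{−s−β₁})/((1−q^{−s})(1−χ(q)q^{−s}))
= (1−χ(q)q⁻¹)⁻¹ + O(α log q/q)` for `q < D`, `|s−1| < 5α`, with `C = 238 + 19|c′|`.
[cite: Zhang2022LandauSiegel, App. A p. 105] -/
theorem stepA_u037_holds (c' : ℝ) : AppendixA2.StepA_u037 c' := by
  refine ⟨238 + 19 * |c'|, ⌈Real.exp (3 + |c'|)⌉₊, fun D _ χ hD _ _ _ q s hq hqD hs => ?_⟩
  obtain ⟨hα0, -, -, hb1, -⟩ := params hD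
  obtain ⟨hx, -, h1x, hqx, -⟩ := perPrime hD hq hqD.le hs
  have hq0 : (q : ℂ) ≠ 0 := by exact_mod_cast hq.ne_zero
  have hlog0 : 0 ≤ Real.log q := Real.log_natCast_nonneg _
  obtain ⟨hw, hw1⟩ := norm_cpow_neg_beta1 c' (D := D) hq.pos
  have hv := DirichletCharacter.norm_le_one χ (q : ZMod D)
  have e : AppendixA2.zetaFactor2 c' χ q s - 1 / (1 - χ (q : ZMod D) * (q : ℂ)⁻¹) =
      locPref (χ (q : ZMod D)) ((q : ℂ) ^ (-Skeleton.beta1 c' D)) ((q : ℂ) ^ (-s)) -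
        (1 - χ (q : ZMod D) / q)⁻¹ := by
    unfold AppendixA2.zetaFactor2 locPref
    rw [neg_add, Complex.cpow_add _ _ hq0, one_div, div_eq_mul_inv (χ _) (q : ℂ), mul_comm ((q : ℂ) ^ (-s))]
  rw [e]
  calc _ ≤ (38 * ‖(q : ℂ) ^ (-Skeleton.beta1 c' D) - 1‖ + 20 * ‖1 - (q : ℂ) * (q : ℂ) ^ (-s)‖) / q :=
        norm_locPref_sub_inv_le hv hx hqx hq.two_le
    _ ≤ (38 * (|Skeleton.b1 c' D| * Real.log q) + 20 * (2 * ‖s - 1‖ * Real.log q)) / q := by gcongr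
    _ ≤ (38 * ((1 + |c'| / 2) * Skeleton.alpha D * Real.log q) +
          20 * (2 * (5 * Skeleton.alpha D) * Real.log q)) / q := by gcongr
    _ = (238 + 19 * |c'|) * (Skeleton.alpha D * Real.log q / q) := by ring

variable (c' : ℝ) in
/-- `StepA_u037` — `_holds` alias of `stepA_u037_holds` above under the fact's exact name, stated under the
prover's own binders as section variables (appended 2026-08-28, D-0026 bookkeeping: the proof term is the
existing theorem of this file; no statement, definition or attribute is edited; no new named fact; the
ledger's debt table listed the fact unproved). [cite: Zhang2022LandauSiegel, App. A p. 105] -/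
theorem _root_.Literature.NumberTheory.LFunctions.Zhang2022.Typed.AppendixA2.StepA_u037_holds :
    _root_.Literature.NumberTheory.LFunctions.Zhang2022.Typed.AppendixA2.StepA_u037 c' :=
  _root_.Literature.NumberTheory.LFunctions.Zhang2022.AppendixA.stepA_u037_holds (c' := c')

variable (c' : ℝ) {D : ℕ} (χ : DirichletCharacter ℂ D) in
/-- `‖c_d‖ ≤ 2` and `‖λ̃₂(q,d)‖ ≤ 2`, `‖λ̃₂(q,d) − 1‖ ≤ 2|b₁|log q/q` at a prime `q ≥ 2` with
`|b₁| log q ≤ 1/5`. [cite: Zhang2022LandauSiegel, App. A p. 105] -/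
private theorem local_sizes {q : ℕ} (hq : q.Prime) (d : ℕ) (hb : |Skeleton.b1 c' D| * Real.log q ≤ 1 / 5) :
    ‖(if Nat.Coprime q d then
        (1 - (q : ℂ) ^ (-Skeleton.beta1 c' D) * (χ (q : ZMod D) / q))⁻¹ else (1 : ℂ))‖ ≤ 2 ∧
    ‖(if Nat.Coprime q d then
        locLam (χ (q : ZMod D)) ((q : ℂ) ^ (-Skeleton.beta1 c' D)) q else 1) - 1‖ ≤
        2 * (|Skeleton.b1 c' D| * Real.log q) / q ∧
    ‖(if Nat.Coprime q d then
        locLam (χ (q : ZMod D)) ((q : ℂ) ^ (-Skeleton.beta1 c' D)) q else 1)‖ ≤ 2 := by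
  have hq0' : (0 : ℝ) < q := by exact_mod_cast hq.pos
  have hq2 : (2 : ℝ) ≤ q := by exact_mod_cast hq.two_le
  obtain ⟨hw, hw1⟩ := norm_cpow_neg_beta1 c' (D := D) hq.pos
  have hv := DirichletCharacter.norm_le_one χ (q : ZMod D)
  have hB0 : 0 ≤ |Skeleton.b1 c' D| * Real.log q := mul_nonneg (abs_nonneg _) (Real.log_natCast_nonneg _)
  have hc : ‖(if Nat.Coprime q d then
      (1 - (q : ℂ) ^ (-Skeleton.beta1 c' D) * (χ (q : ZMod D) / q))⁻¹ else (1 : ℂ))‖ ≤ 2 := by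
    split_ifs
    · have hy : ‖(q : ℂ) ^ (-Skeleton.beta1 c' D) * (χ (q : ZMod D) / q)‖ ≤ 1 / 2 := by
        rw [norm_mul, hw, one_mul, norm_div, Complex.norm_natCast, div_le_iff₀ hq0']; linarith
      have h1 : 1 / 2 ≤ ‖1 - (q : ℂ) ^ (-Skeleton.beta1 c' D) * (χ (q : ZMod D) / q)‖ := by
        have := norm_sub_norm_le (1 : ℂ) ((q : ℂ) ^ (-Skeleton.beta1 c' D) * (χ (q : ZMod D) / q))
        rw [norm_one] at this; linarith
      rw [norm_inv]
      calc _ ≤ (1 / 2 : ℝ)⁻¹ := inv_anti₀ (by norm_num) h1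
        _ = 2 := by norm_num
    · rw [norm_one]; norm_num
  have hl1 : ‖(if Nat.Coprime q d then
      locLam (χ (q : ZMod D)) ((q : ℂ) ^ (-Skeleton.beta1 c' D)) q else 1) - 1‖ ≤
      2 * (|Skeleton.b1 c' D| * Real.log q) / q := by
    split_ifs
    · exact norm_locLam_sub_one_le hv hq.two_le hw1
    · rw [sub_self, norm_zero]; positivity
  refine ⟨hc, hl1, ?_⟩
  have h2 : 2 * (|Skeleton.b1 c' D| * Real.log q) / q ≤ 1 := by
    rw [div_le_one hq0']; nlinarith
  calc _ = ‖((if Nat.Coprime q d then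
          locLam (χ (q : ZMod D)) ((q : ℂ) ^ (-Skeleton.beta1 c' D)) q else 1) - 1) + 1‖ := by
        rw [sub_add_cancel]
    _ ≤ ‖(if Nat.Coprime q d then
          locLam (χ (q : ZMod D)) ((q : ℂ) ^ (-Skeleton.beta1 c' D)) q else 1) - 1‖ + ‖(1 : ℂ)‖ :=
        norm_add_le _ _
    _ ≤ 1 + 1 := by rw [norm_one]; gcongr; exact hl1.trans h2
    _ = 2 := by norm_num

/-- **u036 holds** (`Typed.AppendixA2.StepA_u036 c′`): for `q ∣ l` the local factor's series part is
`O(α log q/q)` (no `r = 1` main term), with `C = 20 + 10|c′|`. [cite: Zhang2022LandauSiegel, App. A p. 105] -/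
theorem stepA_u036_holds (c' : ℝ) : AppendixA2.StepA_u036 c' := by
  refine ⟨20 + 10 * |c'|, ⌈Real.exp (3 + |c'|)⌉₊, fun D _ χ hD _ _ _ q d l s hq hqD _ _ hql hs => ?_⟩
  obtain ⟨hα0, -, -, hb1, -⟩ := params hD
  obtain ⟨hx, hx2, -, -, hb⟩ := perPrime hD hq hqD.le hs
  have hlt : ‖(q : ℂ) ^ (-s)‖ < 1 := lt_of_le_of_lt hx (by norm_num)
  have hlog0 : 0 ≤ Real.log q := Real.log_natCast_nonneg _
  obtain ⟨hw, hw1⟩ := norm_cpow_neg_beta1 c' (D := D) hq.pos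
  obtain ⟨hc, -, hlam⟩ := local_sizes c' χ hq d hb
  have hncop : ¬ Nat.Coprime q l := fun h => hq.ne_one (h.eq_one_of_dvd hql)
  have hS : 1 + Section16A.lamTilde2 c' χ q d * Section16A.xi2LocalSeries c' χ q d l s - 1 =
      (if Nat.Coprime q d then locLam (χ (q : ZMod D)) ((q : ℂ) ^ (-Skeleton.beta1 c' D)) q else 1) *
        ((if Nat.Coprime q d then
            (1 - (q : ℂ) ^ (-Skeleton.beta1 c' D) * (χ (q : ZMod D) / q))⁻¹ else (1 : ℂ)) *
          ((q : ℂ) ^ (-Skeleton.beta1 c' D) - 1) * (q : ℂ) ^ (-s) /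
          (1 - (q : ℂ) ^ (-Skeleton.beta1 c' D) * (q : ℂ) ^ (-s))) := by
    rw [xi2LocalSeries_prime c' χ hq d l s hlt, if_neg hncop, lamTilde2_prime c' χ hq d]
    ring
  rw [hS]
  calc _ ≤ 20 * (|Skeleton.b1 c' D| * Real.log q) / q :=
        norm_lam_mul_locTerm_le hlam hc hw.le hx hq.pos hx2 hw1
    _ ≤ 20 * ((1 + |c'| / 2) * Skeleton.alpha D * Real.log q) / q := by gcongr
    _ = (20 + 10 * |c'|) * (Skeleton.alpha D * Real.log q / q) := by ring

variable (c' : ℝ) in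
/-- `StepA_u036` — `_holds` alias of `stepA_u036_holds` above under the fact's exact name, stated under the
prover's own binders as section variables (appended 2026-08-28, D-0026 bookkeeping: the proof term is the
existing theorem of this file; no statement, definition or attribute is edited; no new named fact; the
ledger's debt table listed the fact unproved). [cite: Zhang2022LandauSiegel, App. A p. 105] -/
theorem _root_.Literature.NumberTheory.LFunctions.Zhang2022.Typed.AppendixA2.StepA_u036_holds :
    _root_.Literature.NumberTheory.LFunctions.Zhang2022.Typed.AppendixA2.StepA_u036 c' :=
  _root_.Literature.NumberTheory.LFunctions.Zhang2022.AppendixA.stepA_u036_holds (c' := c')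

/-- **u035 holds** (`Typed.AppendixA2.StepA_u035 c′`): for `(q,l) = 1` the local factor's series part is
`1 − χ(q)/(q−1) + O(α log q/q)` (the `r = 1` term carries `κ₂(1) = 1`), with `C = 147 + 34|c′|`.
[cite: Zhang2022LandauSiegel, App. A p. 105] -/
theorem stepA_u035_holds (c' : ℝ) : AppendixA2.StepA_u035 c' := by
  refine ⟨147 + 34 * |c'|, ⌈Real.exp (3 + |c'|)⌉₊, fun D _ χ hD _ _ _ q d l s hq hqD _ _ hql hs => ?_⟩
  obtain ⟨hα0, -, -, hb1, -⟩ := params hD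
  obtain ⟨hx, hx2, h1x, -, hb⟩ := perPrime hD hq hqD.le hs
  have hlt : ‖(q : ℂ) ^ (-s)‖ < 1 := lt_of_le_of_lt hx (by norm_num)
  have hq0' : (0 : ℝ) < q := by exact_mod_cast hq.pos
  have hq2 : (2 : ℝ) ≤ q := by exact_mod_cast hq.two_le
  have hlog0 : 0 ≤ Real.log q := Real.log_natCast_nonneg _
  obtain ⟨hw, hw1⟩ := norm_cpow_neg_beta1 c' (D := D) hq.pos
  have hv := DirichletCharacter.norm_le_one χ (q : ZMod D)
  obtain ⟨hc, hl1, -⟩ := local_sizes c' χ hq d hb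
  have hS : 1 + Section16A.lamTilde2 c' χ q d * Section16A.xi2LocalSeries c' χ q d l s -
      (1 - χ (q : ZMod D) / ((q : ℂ) - 1)) =
      (if Nat.Coprime q d then locLam (χ (q : ZMod D)) ((q : ℂ) ^ (-Skeleton.beta1 c' D)) q else 1) *
        ((if Nat.Coprime q d then
            (1 - (q : ℂ) ^ (-Skeleton.beta1 c' D) * (χ (q : ZMod D) / q))⁻¹ else (1 : ℂ)) *
            ((q : ℂ) ^ (-Skeleton.beta1 c' D) - 1) * (q : ℂ) ^ (-s) /
            (1 - (q : ℂ) ^ (-Skeleton.beta1 c' D) * (q : ℂ) ^ (-s)) -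
          χ (q : ZMod D) * q / ((q : ℂ) - 1) *
            ((q : ℂ) ^ (-s) * (1 - (q : ℂ) ^ (-s)) / (1 - (q : ℂ) ^ (-Skeleton.beta1 c' D) * (q : ℂ) ^ (-s)))) +
        χ (q : ZMod D) / ((q : ℂ) - 1) := by
    rw [xi2LocalSeries_prime c' χ hq d l s hlt, if_pos hql, lamTilde2_prime c' χ hq d]
    ring
  rw [hS]
  have hBw1 : |Skeleton.b1 c' D| * Real.log q ≤ 1 := by linarith
  calc _ ≤ (41 * (|Skeleton.b1 c' D| * Real.log q) + 8 * (2 * ‖s - 1‖ * Real.log q) +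
          26 * (2 * (|Skeleton.b1 c' D| * Real.log q) / q)) / q :=
        norm_lam_mul_locSer_add_le hv hw.le hx hq.two_le hx2 hc hw1 hBw1 h1x hl1
    _ ≤ (41 * (|Skeleton.b1 c' D| * Real.log q) + 8 * (2 * ‖s - 1‖ * Real.log q) +
          26 * (|Skeleton.b1 c' D| * Real.log q)) / q := by
        gcongr
        rw [div_le_iff₀ hq0']
        nlinarith [mul_nonneg (abs_nonneg (Skeleton.b1 c' D)) hlog0]
    _ ≤ (41 * ((1 + |c'| / 2) * Skeleton.alpha D * Real.log q) +
          8 * (2 * (5 * Skeleton.alpha D) * Real.log q) +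
          26 * ((1 + |c'| / 2) * Skeleton.alpha D * Real.log q)) / q := by gcongr
    _ = (147 + 67 / 2 * |c'|) * (Skeleton.alpha D * Real.log q / q) := by ring
    _ ≤ (147 + 34 * |c'|) * (Skeleton.alpha D * Real.log q / q) := by
        have h0 : 0 ≤ Skeleton.alpha D * Real.log q / q := div_nonneg (mul_nonneg hα0 hlog0) hq0'.le
        nlinarith [abs_nonneg c']

variable (c' : ℝ) in
/-- `StepA_u035` — `_holds` alias of `stepA_u035_holds` above under the fact's exact name, stated under the
prover's own binders as section variables (appended 2026-08-28, D-0026 bookkeeping: the proof term is the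
existing theorem of this file; no statement, definition or attribute is edited; no new named fact; the
ledger's debt table listed the fact unproved). [cite: Zhang2022LandauSiegel, App. A p. 105] -/
theorem _root_.Literature.NumberTheory.LFunctions.Zhang2022.Typed.AppendixA2.StepA_u035_holds :
    _root_.Literature.NumberTheory.LFunctions.Zhang2022.Typed.AppendixA2.StepA_u035 c' :=
  _root_.Literature.NumberTheory.LFunctions.Zhang2022.AppendixA.stepA_u035_holds (c' := c')

/- `Z22:Lem16.1.pf` (`Typed.AppendixA2.Lem161_pf c′`) is already the tree theorem
`Typed.AppendixA2.lem161_pf_holds` (TypedAppendixA2.lean v4, via `lemma161_holds`); it is cited, not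
re-declared here. -/

end TypedSteps

end Literature.NumberTheory.LFunctions.Zhang2022.AppendixA
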